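import Summits.ValiantsHypothesis.ValiantsHypothesis.Theorems.KPlusLogSqLawTropicalBIsotoneRegisters

/-!
# `TropicalB` (stmt-ValiantsHypothesis-19771) — lattice-coupled additive registers with ARBITRARY slope tables: the two MOVER LAWS

Second helper file of the seat val-sym-trop-p5 g6 (cell `pub-symmetroid`, 2026-08-27) on top of
`…TropicalBIsotoneRegisters` (p501272: ISOTONE registers under any min/max-closed coupling are additive, Topkis).  HONEST FRAMING: a
structure law about sub-families of the terms of an ARBITRARY dominance design (tree vocabulary `IsDominant`, `tropWeight`, `termSign`);
nothing about `TropicalB` in its window, `WeakLifting`, `MatrixDescartes` (stmt-18050) or VP ≠ VNP.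

## Statement
Same frame as p501272 WITHOUT the isotonicity hypothesis: configurations `x : Fin r → Fin n`, any feasibility predicate `P` closed under
pointwise `⊓/⊔`, terms `τ x` present and pairwise distinct on `P`, additive weights `θ·Σ_i s i (x i) − Σ_i A i (x i)` with ARBITRARY integer
slope tables `s`.  For two members `x` (dominant at `θ₁`) and `y` (dominant at `θ₂ > θ₁`) — consecutive or not —
* `sum_down_movers_lt` (law I): if some register is LOWER in `y`, then `Σ_{i : y i < x i} s i (x i) < Σ_{i : y i < x i} s i (y i)`;
* `sum_up_movers_lt` (law II): if some register is HIGHER in `y`, then `Σ_{i : x i < y i} s i (x i) < Σ_{i : x i < y i} s i (y i)`.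
The familiar «total slope increases along a dominant chain» (`slope_lt_of_dominant`) is the SUM of the two laws; the lattice coupling
splits it into the up-moving and the down-moving registers separately.  With isotone tables law I is impossible, which is p501272's
`le_of_dominant` (Topkis); with general tables the laws say what a super-additive lattice architecture (e.g. the Carstensen-hard grids =
comparability chains, Gajjar–Radhakrishnan 2018 Cor. 3) must do: move GROUPS of registers co-directionally with individual slope losses
inside the group — a register that is the only one displaced in its direction between two slopes has strictly gained slope.

## Proof
Abstract lattice form (`Lattice.slope_sup_lt_of_not_le`, `Lattice.slope_lt_sup_of_not_ge`): `F` closed under `⊓, ⊔`, `S, A` modular on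
`F`; with `u = x ⊓ y`, `w = x ⊔ y`: if `x ≰ y` then `u ≠ x`, `w ≠ y`, so `W₁ u < W₁ x`, `W₂ w < W₂ y`, and modularity turns the first
into `W₁ w > W₁ y`; the line `θ ↦ W_θ w − W_θ y` is positive at `θ₁` and negative at `θ₂ > θ₁`, hence has negative slope
`S w − S y < 0`.  Law II symmetrically with `W_θ w − W_θ x`.  The register form rewrites `S (x ⊔ y) − S y` as the sum over the
registers with `y i < x i` (`sum_sup_sub_sum_eq`).  [folklore: exchange/modularity on a lattice; the packaging is the cell's]
-/

set_option linter.dupNamespace false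
set_option autoImplicit false

namespace Summit.ValiantsHypothesis.ValiantsHypothesis.Theorems.KPlusLogSqLaw.IsotoneRegisters

open Summit.ValiantsHypothesis.ValiantsHypothesis.Theorems.MatrixDescartes.Negative
open Finset

/-! ## The two MOVER LAWS of a lattice coupling (general slope tables)

Without isotonicity nothing is additive in general (grids, §«dichotomy» of the module docstring), but the lattice structure still
forces a sign law on EVERY pair of dominant members, consecutive or not: between an earlier optimum `x` (slope `θ₁`) and a later one
`y` (slope `θ₂ > θ₁`), the registers that are LOWER at `θ₂` gained slope in aggregate (`S (x ⊔ y) < S y`, law I) and the registers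
that are HIGHER at `θ₂` gained slope in aggregate (`S x < S (x ⊔ y)`, law II).  (The familiar «total slope increases» is the sum of
the two; isotone tables make law I impossible, which is Topkis.)  So a super-additive lattice architecture must move GROUPS of
registers co-directionally with individual slope losses inside the group — a register that is the only one displaced in its
direction between two slopes has strictly gained slope. -/

section MoverLaws

variable {α : Type*} [Lattice α]

/-- **Mover law I (abstract).**  `F` closed under `⊓, ⊔`; `S, A` modular on `F`; `x` the unique maximiser of `θ₁·S − A` over `F`,
`y` that of `θ₂·S − A`, `θ₁ < θ₂`.  If NOT `x ≤ y` then `S (x ⊔ y) < S y` (and, by modularity, `S x < S (x ⊓ y)`). -/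
theorem Lattice.slope_sup_lt_of_not_le {F : Set α}
    (hinf : ∀ x ∈ F, ∀ y ∈ F, x ⊓ y ∈ F) (hsup : ∀ x ∈ F, ∀ y ∈ F, x ⊔ y ∈ F)
    (S A : α → ℤ)
    (hS : ∀ x ∈ F, ∀ y ∈ F, S (x ⊓ y) + S (x ⊔ y) = S x + S y)
    (hA : ∀ x ∈ F, ∀ y ∈ F, A (x ⊓ y) + A (x ⊔ y) = A x + A y)
    {θ₁ θ₂ : ℤ} (hθ : θ₁ < θ₂) {x y : α} (hx : x ∈ F) (hy : y ∈ F)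
    (hx1 : ∀ z ∈ F, z ≠ x → θ₁ * S z - A z < θ₁ * S x - A x)
    (hy2 : ∀ z ∈ F, z ≠ y → θ₂ * S z - A z < θ₂ * S y - A y) (hxy : ¬ x ≤ y) :
    S (x ⊔ y) < S y ∧ S x < S (x ⊓ y) := by
  have hu : x ⊓ y ≠ x := fun e => hxy (inf_eq_left.1 e)
  have hw : x ⊔ y ≠ y := fun e => hxy (sup_eq_right.1 e)
  have h1 := hx1 (x ⊓ y) (hinf x hx y hy) hu
  have h2 := hy2 (x ⊔ y) (hsup x hx y hy) hw
  have hSm := hS x hx y hy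
  have hAm := hA x hx y hy
  -- `W_θ (x ⊔ y) − W_θ y` is `> 0` at `θ₁` (modularity + optimality of `x`) and `< 0` at `θ₂`
  have e1 : θ₁ * S (x ⊓ y) + θ₁ * S (x ⊔ y) = θ₁ * S x + θ₁ * S y := by rw [← mul_add, ← mul_add, hSm]
  have hlt : (θ₂ - θ₁) * (S (x ⊔ y) - S y) < 0 := by nlinarith
  have hD : S (x ⊔ y) - S y < 0 := by
    by_contra hcon
    push Not at hcon
    have : 0 ≤ (θ₂ - θ₁) * (S (x ⊔ y) - S y) := mul_nonneg (by linarith) hcon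
    linarith
  constructor
  · linarith
  · linarith

/-- **Mover law II (abstract).**  Same hypotheses; if NOT `y ≤ x` then `S x < S (x ⊔ y)` (and `S (x ⊓ y) < S y`). -/
theorem Lattice.slope_lt_sup_of_not_ge {F : Set α}
    (hinf : ∀ x ∈ F, ∀ y ∈ F, x ⊓ y ∈ F) (hsup : ∀ x ∈ F, ∀ y ∈ F, x ⊔ y ∈ F)
    (S A : α → ℤ)
    (hS : ∀ x ∈ F, ∀ y ∈ F, S (x ⊓ y) + S (x ⊔ y) = S x + S y)
    (hA : ∀ x ∈ F, ∀ y ∈ F, A (x ⊓ y) + A (x ⊔ y) = A x + A y)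
    {θ₁ θ₂ : ℤ} (hθ : θ₁ < θ₂) {x y : α} (hx : x ∈ F) (hy : y ∈ F)
    (hx1 : ∀ z ∈ F, z ≠ x → θ₁ * S z - A z < θ₁ * S x - A x)
    (hy2 : ∀ z ∈ F, z ≠ y → θ₂ * S z - A z < θ₂ * S y - A y) (hyx : ¬ y ≤ x) :
    S x < S (x ⊔ y) ∧ S (x ⊓ y) < S y := by
  have hu : x ⊓ y ≠ y := fun e => hyx (inf_eq_right.1 e)
  have hw : x ⊔ y ≠ x := fun e => hyx (sup_eq_left.1 e)
  have h1 := hx1 (x ⊔ y) (hsup x hx y hy) hw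
  have h2 := hy2 (x ⊓ y) (hinf x hx y hy) hu
  have hSm := hS x hx y hy
  have hAm := hA x hx y hy
  -- `W_θ (x ⊔ y) − W_θ x` is `< 0` at `θ₁` and `> 0` at `θ₂` (modularity + optimality of `y`)
  have e2 : θ₂ * S (x ⊓ y) + θ₂ * S (x ⊔ y) = θ₂ * S x + θ₂ * S y := by rw [← mul_add, ← mul_add, hSm]
  have hlt : 0 < (θ₂ - θ₁) * (S (x ⊔ y) - S x) := by nlinarith
  have hD : 0 < S (x ⊔ y) - S x := by
    by_contra hcon
    push Not at hcon
    have : (θ₂ - θ₁) * (S (x ⊔ y) - S x) ≤ 0 := mul_nonpos_of_nonneg_of_nonpos (by linarith) hcon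
    linarith
  constructor
  · linarith
  · linarith

variable {r n : ℕ}

/-- `Σ_i s i ((x ⊔ y) i) − Σ_i s i (y i)` is the aggregate slope change of the registers that are higher in `x` than in `y`. -/
theorem sum_sup_sub_sum_eq (s : Fin r → Fin n → ℤ) (x y : Fin r → Fin n) :
    (∑ i, s i ((x ⊔ y) i)) - ∑ i, s i (y i) =
      ∑ i ∈ (Finset.univ : Finset (Fin r)).filter (fun i => y i < x i), (s i (x i) - s i (y i)) := by
  classical
  rw [← Finset.sum_sub_distrib, Finset.sum_filter]
  refine Finset.sum_congr rfl fun i _ => ?_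
  rw [Pi.sup_apply]
  by_cases h : y i < x i
  · rw [if_pos h, sup_eq_left.2 h.le]
  · rw [if_neg h, sup_eq_right.2 (not_lt.1 h), sub_self]

variable {m K : ℕ}
  (d : Fin K → ℕ) (v ε : Fin m → Fin m → Fin K → ℤ)
  (P : (Fin r → Fin n) → Prop)
  (τ : (Fin r → Fin n) → Equiv.Perm (Fin m) × (Fin m → Fin K))
  (s A : Fin r → Fin n → ℤ)
  (hPinf : ∀ x y, P x → P y → P (x ⊓ y)) (hPsup : ∀ x y, P x → P y → P (x ⊔ y))
  (hinj : ∀ x y, P x → P y → τ x = τ y → x = y)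
  (hpres : ∀ x, P x → termSign ε (τ x) ≠ 0)
  (hw : ∀ x (θ : ℤ), P x → tropWeight d v θ (τ x) = θ * (∑ i, s i (x i)) - ∑ i, A i (x i))

include hPinf hPsup hinj hpres hw in
/-- **MOVER LAW I for lattice-coupled additive registers (arbitrary slope tables).**  If `x` is dominant at `θ₁`, `y` at `θ₂ > θ₁`,
and some register is LOWER in `y` than in `x`, then those registers gained slope in aggregate:
`Σ_{i : y i < x i} s i (x i) < Σ_{i : y i < x i} s i (y i)`. -/
theorem sum_down_movers_lt {x y : Fin r → Fin n} {θ₁ θ₂ : ℤ} (hθ : θ₁ < θ₂) (hx : P x) (hy : P y)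
    (hdx : IsDominant d v ε θ₁ (τ x)) (hdy : IsDominant d v ε θ₂ (τ y)) (hdown : ∃ i, y i < x i) :
    (∑ i ∈ (Finset.univ : Finset (Fin r)).filter (fun i => y i < x i), s i (x i)) <
      ∑ i ∈ (Finset.univ : Finset (Fin r)).filter (fun i => y i < x i), s i (y i) := by
  classical
  have hxy : ¬ x ≤ y := by
    obtain ⟨i, hi⟩ := hdown
    exact fun h => not_lt.2 (h i) hi
  have hlaw := (Lattice.slope_sup_lt_of_not_le (F := {z | P z}) (fun a ha b hb => hPinf a b ha hb)
    (fun a ha b hb => hPsup a b ha hb) (fun z => ∑ i, s i (z i)) (fun z => ∑ i, A i (z i))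
    (fun a _ b _ => sum_inf_add_sum_sup s a b) (fun a _ b _ => sum_inf_add_sum_sup A a b) hθ hx hy
    (fun _ hz hne => weight_lt d v ε P τ s A hinj hpres hw hx hz hne hdx)
    (fun _ hz hne => weight_lt d v ε P τ s A hinj hpres hw hy hz hne hdy) hxy).1
  have heq := sum_sup_sub_sum_eq s x y
  have hlt : ∑ i ∈ (Finset.univ : Finset (Fin r)).filter (fun i => y i < x i), (s i (x i) - s i (y i)) < 0 := by
    rw [← heq]; linarith
  rw [Finset.sum_sub_distrib] at hlt
  linarith

include hPinf hPsup hinj hpres hw in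
/-- **MOVER LAW II for lattice-coupled additive registers (arbitrary slope tables).**  If `x` is dominant at `θ₁`, `y` at `θ₂ > θ₁`,
and some register is HIGHER in `y` than in `x`, then those registers gained slope in aggregate:
`Σ_{i : x i < y i} s i (x i) < Σ_{i : x i < y i} s i (y i)`. -/
theorem sum_up_movers_lt {x y : Fin r → Fin n} {θ₁ θ₂ : ℤ} (hθ : θ₁ < θ₂) (hx : P x) (hy : P y)
    (hdx : IsDominant d v ε θ₁ (τ x)) (hdy : IsDominant d v ε θ₂ (τ y)) (hup : ∃ i, x i < y i) :
    (∑ i ∈ (Finset.univ : Finset (Fin r)).filter (fun i => x i < y i), s i (x i)) <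
      ∑ i ∈ (Finset.univ : Finset (Fin r)).filter (fun i => x i < y i), s i (y i) := by
  classical
  have hyx : ¬ y ≤ x := by
    obtain ⟨i, hi⟩ := hup
    exact fun h => not_lt.2 (h i) hi
  have hlaw := (Lattice.slope_lt_sup_of_not_ge (F := {z | P z}) (fun a ha b hb => hPinf a b ha hb)
    (fun a ha b hb => hPsup a b ha hb) (fun z => ∑ i, s i (z i)) (fun z => ∑ i, A i (z i))
    (fun a _ b _ => sum_inf_add_sum_sup s a b) (fun a _ b _ => sum_inf_add_sum_sup A a b) hθ hx hy
    (fun _ hz hne => weight_lt d v ε P τ s A hinj hpres hw hx hz hne hdx)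
    (fun _ hz hne => weight_lt d v ε P τ s A hinj hpres hw hy hz hne hdy) hyx).1
  -- `x ⊔ y = y ⊔ x`; the registers higher in `y` are those with `x i < y i`
  have heq := sum_sup_sub_sum_eq s y x
  rw [sup_comm] at heq
  have hlt : 0 < ∑ i ∈ (Finset.univ : Finset (Fin r)).filter (fun i => x i < y i), (s i (y i) - s i (x i)) := by
    rw [← heq]; linarith
  rw [Finset.sum_sub_distrib] at hlt
  linarith

end MoverLaws

end Summit.ValiantsHypothesis.ValiantsHypothesis.Theorems.KPlusLogSqLaw.IsotoneRegisters
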